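import Summits.NavierStokesRegularity.FluidComputer.AngularGalerkinLadderBasics

/-!
# The angular Galerkin ladder: the Laplacian commutes with the Casimir cut — the viscous term
# of `NS_L` stays in the band (theorems only)

Cell `ns-blowup`, seat `ns-blowup-lean` (g11). LABEL: KERNEL typing hygiene for the vocabulary of
`FluidComputer/AngularGalerkinLadder.lean` (route `Theses/AngularGalerkinLadder.lean`, tribunal
round 1 PASSED). WHAT THIS IS NOT: not Navier–Stokes evidence — a calculus identity (the rotation
generators commute with the vector Laplacian on smooth fields) and its bookkeeping consequences;
nothing is asserted about the dynamics, regularity or blow-up of any rung, no profile is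
constructed, no crux is touched.

## Content

§1 (general finite-dimensional real inner product space `E`, real normed space `F`). For a
smooth map `f : E → F` and a continuous linear field `K : E →L[ℝ] E` write
`X_K f := (y ↦ Df(y)(K y))` for the derivative of `f` along the linear vector field `y ↦ K y`
(for `E = ℝ³`, `K = [e_a]_×` this is the transport part `((e_a × y)·∇)f` of the rotation
generator `J_a`). Using ONLY the symmetry of second derivatives (Schwarz; Mathlib
`ContDiffAt.isSymmSndFDerivAt`):
* `fderiv_fderiv_apply_clm_comm`: the commutator `[∂_v, X_K] f = ∂_{Kv} f`;
* `fderiv_fderiv_fderiv_apply_clm`: `∂_v∂_v (X_K f) = X_K (∂_v∂_v f) + 2 D²f(Kv, v)`;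
* `sum_apply_clm_apply_eq_zero_of_skew`: `Σ_i B(K b_i, b_i) = 0` over an orthonormal basis for a
  symmetric bilinear `B` and a SKEW `K` (`⟪Kv, w⟫ = −⟪v, Kw⟫`);
* **`laplacian_fderiv_apply_clm_of_skew`: `Δ (X_K f) = X_K (Δ f)` for skew `K`** — derivatives
  along Killing (rotation) fields commute with the Laplacian.

§2 (`ℝ³`, the vocabulary). `angGen a u = [e_a]_× ∘ u − X_{[e_a]_×} u` with `[e_a]_×` skew, and
`Δ ([e_a]_× ∘ u) = [e_a]_× ∘ Δ u` (Mathlib `ContDiffAt.laplacian_CLM_comp_left`), hence for smooth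
`u : ℝ³ → ℝ³`:
* `angGen_laplacian`: `J_a (Δ u) = Δ (J_a u)`; `casimir_laplacian`: `𝒞 (Δ u) = Δ (𝒞 u)`;
  `bandDefect_laplacian`: `∏_{j ≤ L}(𝒞 − j(j+1)) (Δ u) = Δ (∏_{j ≤ L}(𝒞 − j(j+1)) u)`;
* **`IsBandLimited.laplacian`: a field band-limited to angular degrees `≤ L` has a band-limited
  Laplacian** (the isotypic projections `Π_L` commute with `Δ`, stated without a projection
  operator), with the iterates `IsBandLimited.iterate_laplacian` and the viscous term
  `IsBandLimited.viscous` (`ν Δ u`);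
* `IsRungSolutionOn.isBandLimited_laplacian` / `…_viscous`: on every rung-`L` solution the
  viscous term `ν Δ u(t)` of the momentum equation is band-limited of degree `≤ L` for `t ∈ S` —
  the Δ-clause of the route's structure lemma («`Π_L` commutes with the Laplacian», module
  docstring of `AngularGalerkinLadder.lean`), which together with the rotation, dilation and
  radial-multiplier clauses (`AngularGalerkinLadderRotation/Scaling/RadialCutoff.lean`) leaves
  only the Leray-projection clause of that lemma untyped.

References: [cite: BullardGellman1954] (vector spherical harmonics with radial coefficients: the
Laplacian preserves each isotype); [cite: Tao2016AveragedNS, Thm. 1.5] (rotation averages as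
order-zero multipliers commuting with `Δ`).
-/

noncomputable section

namespace Summit.NavierStokesRegularity.FluidComputer

open Set MeasureTheory Filter Topology Function
open scoped ContDiff RealInnerProductSpace Laplacian
open Literature.Analysis.FluidPDE

namespace AngularLadder

/-! ## §1 Derivatives along linear vector fields and the Laplacian (general `E`, `F`) -/

section Calculus

variable {E : Type*} [NormedAddCommGroup E] [InnerProductSpace ℝ E]
  {F : Type*} [NormedAddCommGroup F] [NormedSpace ℝ F]
  {f : E → F}

/-- The derivative field of a smooth map is smooth. [folklore] -/
private theorem contDiff_fderiv_of_smooth (hf : ContDiff ℝ ∞ f) : ContDiff ℝ ∞ (fderiv ℝ f) :=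
  (contDiff_infty_iff_fderiv.1 hf).2

/-- A directional derivative `y ↦ Df(y) v` of a smooth map along a fixed vector is smooth.
[folklore] -/
theorem contDiff_fderiv_apply_const (hf : ContDiff ℝ ∞ f) (v : E) :
    ContDiff ℝ ∞ fun y => fderiv ℝ f y v :=
  (contDiff_fderiv_of_smooth hf).clm_apply contDiff_const

/-- The derivative `X_K f = (y ↦ Df(y)(K y))` of a smooth map along a linear vector field
`y ↦ K y` is smooth. [folklore] -/
theorem contDiff_fderiv_apply_clm (hf : ContDiff ℝ ∞ f) (K : E →L[ℝ] E) :
    ContDiff ℝ ∞ fun y => fderiv ℝ f y (K y) :=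
  (contDiff_fderiv_of_smooth hf).clm_apply K.contDiff

/-- Second directional derivatives through the second derivative: `∂_w ∂_v f (x) = D²f(x)(w)(v)`.
[folklore] -/
theorem fderiv_fderiv_apply_const (hf : ContDiff ℝ ∞ f) (x v w : E) :
    fderiv ℝ (fun y => fderiv ℝ f y v) x w = fderiv ℝ (fderiv ℝ f) x w v := by
  have hc : DifferentiableAt ℝ (fderiv ℝ f) x :=
    (contDiff_fderiv_of_smooth hf).differentiable (by simp) x
  rw [fderiv_clm_apply hc (differentiableAt_const v)]
  simp

/-- **Schwarz**: the second derivative of a smooth map is symmetric (Mathlib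
`ContDiffAt.isSymmSndFDerivAt`). [folklore] -/
theorem fderiv_fderiv_symm (hf : ContDiff ℝ ∞ f) (x v w : E) :
    fderiv ℝ (fderiv ℝ f) x v w = fderiv ℝ (fderiv ℝ f) x w v := by
  have h2 : (2 : WithTop ℕ∞) ≤ ∞ := ENat.natCast_le_of_coe_top_le_withTop le_rfl 2
  exact (hf.contDiffAt.isSymmSndFDerivAt (by simpa using h2)) v w

/-- The derivative of `X_K f = (y ↦ Df(y)(K y))`:
`D(X_K f)(x) w = D²f(x)(w)(K x) + Df(x)(K w)` (Leibniz rule for the evaluation pairing).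
[folklore] -/
theorem fderiv_fderiv_apply_clm (hf : ContDiff ℝ ∞ f) (K : E →L[ℝ] E) (x w : E) :
    fderiv ℝ (fun y => fderiv ℝ f y (K y)) x w =
      fderiv ℝ (fderiv ℝ f) x w (K x) + fderiv ℝ f x (K w) := by
  have hc : DifferentiableAt ℝ (fderiv ℝ f) x :=
    (contDiff_fderiv_of_smooth hf).differentiable (by simp) x
  rw [fderiv_clm_apply hc K.differentiableAt]
  simp only [ContinuousLinearMap.fderiv, _root_.add_apply, ContinuousLinearMap.coe_comp,
    Function.comp_apply, ContinuousLinearMap.flip_apply]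
  exact add_comm _ _

/-- **The commutator of a directional derivative with the derivative along a linear field**:
`∂_v (X_K f) = X_K (∂_v f) + ∂_{K v} f`, i.e. `[∂_v, X_K] = ∂_{Kv}` — by the symmetry of `D²f`.
[folklore] -/
theorem fderiv_fderiv_apply_clm_comm (hf : ContDiff ℝ ∞ f) (K : E →L[ℝ] E) (x v : E) :
    fderiv ℝ (fun y => fderiv ℝ f y (K y)) x v =
      fderiv ℝ (fun y => fderiv ℝ f y v) x (K x) + fderiv ℝ f x (K v) := by
  rw [fderiv_fderiv_apply_clm hf K x v, fderiv_fderiv_apply_const hf x v (K x),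
    fderiv_fderiv_symm hf x v (K x)]

/-- **Second-order commutator**: `∂_v ∂_v (X_K f) (x) = X_K (∂_v ∂_v f) (x) + 2 D²f(x)(K v)(v)` —
the commutator rule applied twice plus `[∂_v, ∂_{Kv}] = 0` (symmetry of `D²f`). [folklore] -/
theorem fderiv_fderiv_fderiv_apply_clm (hf : ContDiff ℝ ∞ f) (K : E →L[ℝ] E) (x v : E) :
    fderiv ℝ (fun y => fderiv ℝ (fun z => fderiv ℝ f z (K z)) y v) x v =
      fderiv ℝ (fun y => fderiv ℝ (fun z => fderiv ℝ f z v) y v) x (K x) +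
        (2 : ℝ) • fderiv ℝ (fderiv ℝ f) x (K v) v := by
  have hg : ContDiff ℝ ∞ (fun z => fderiv ℝ f z v) := contDiff_fderiv_apply_const hf v
  have h1 : (fun y => fderiv ℝ (fun z => fderiv ℝ f z (K z)) y v) =
      fun y => fderiv ℝ (fun z => fderiv ℝ f z v) y (K y) + fderiv ℝ f y (K v) :=
    funext fun y => fderiv_fderiv_apply_clm_comm hf K y v
  have hA : DifferentiableAt ℝ (fun y => fderiv ℝ (fun z => fderiv ℝ f z v) y (K y)) x :=
    (contDiff_fderiv_apply_clm hg K).differentiable (by simp) x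
  have hB : DifferentiableAt ℝ (fun y => fderiv ℝ f y (K v)) x :=
    (contDiff_fderiv_apply_const hf (K v)).differentiable (by simp) x
  rw [h1, fderiv_fun_add hA hB, _root_.add_apply, fderiv_fderiv_apply_clm_comm hg K x v,
    fderiv_fderiv_apply_const hf x v (K v), fderiv_fderiv_apply_const hf x (K v) v,
    fderiv_fderiv_symm hf x v (K v), two_smul, add_assoc]

/-- **A symmetric bilinear form traced against a skew operator vanishes**: for
`B : E →L E →L F` symmetric, `K` skew-adjoint (`⟪Kv, w⟫ = −⟪v, Kw⟫`) and an orthonormal basis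
`b`, `Σ_i B (K b_i) (b_i) = 0` (expand `K b_i` in the basis: the coefficient matrix is
antisymmetric, `B` is symmetric). [folklore] -/
theorem sum_apply_clm_apply_eq_zero_of_skew {ι : Type*} [Fintype ι] (b : OrthonormalBasis ι ℝ E)
    (B : E →L[ℝ] E →L[ℝ] F) (hB : ∀ v w, B v w = B w v) {K : E →L[ℝ] E}
    (hK : ∀ v w : E, ⟪K v, w⟫ = -⟪v, K w⟫) : ∑ i, B (K (b i)) (b i) = 0 := by
  have hexp : ∀ i, B (K (b i)) (b i) = ∑ j, ⟪b j, K (b i)⟫ • B (b j) (b i) := fun i => by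
    conv_lhs => rw [← b.sum_repr' (K (b i))]
    simp only [map_sum, map_smul, _root_.sum_apply, _root_.smul_apply]
  have hneg : ∑ i, B (K (b i)) (b i) = -∑ i, B (K (b i)) (b i) :=
    calc ∑ i, B (K (b i)) (b i) = ∑ i, ∑ j, ⟪b j, K (b i)⟫ • B (b j) (b i) :=
          Finset.sum_congr rfl fun i _ => hexp i
      _ = ∑ i, ∑ j, -(⟪b i, K (b j)⟫ • B (b i) (b j)) := by
          refine Finset.sum_congr rfl fun i _ => Finset.sum_congr rfl fun j _ => ?_
          rw [hB (b j) (b i), ← neg_smul, ← real_inner_comm (b j) (K (b i)), hK (b i) (b j)]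
      _ = -∑ j, ∑ i, ⟪b i, K (b j)⟫ • B (b i) (b j) := by
          rw [Finset.sum_comm]
          simp only [Finset.sum_neg_distrib]
      _ = -∑ i, B (K (b i)) (b i) := by
          congr 1
          exact (Finset.sum_congr rfl fun j _ => hexp j).symm
  have h2 : (2 : ℝ) • ∑ i, B (K (b i)) (b i) = 0 := by
    rw [two_smul]
    nth_rewrite 2 [hneg]
    exact add_neg_cancel _
  calc ∑ i, B (K (b i)) (b i) = (2 : ℝ)⁻¹ • ((2 : ℝ) • ∑ i, B (K (b i)) (b i)) := by
        rw [smul_smul, inv_mul_cancel₀ (two_ne_zero), one_smul]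
    _ = 0 := by rw [h2, smul_zero]

variable [FiniteDimensional ℝ E]

/-- The Laplacian of a smooth map as the sum of second directional derivatives over an
orthonormal basis: `Δ f = Σ_i ∂_{b_i} ∂_{b_i} f` (Mathlib
`InnerProductSpace.laplacian_eq_iteratedFDeriv_orthonormalBasis`; private twin of the tree's
`laplacian_eq_sum_fderiv_fderiv`). [folklore] -/
private theorem laplacian_eq_sum_fderiv_fderiv' {ι : Type*} [Fintype ι] (b : OrthonormalBasis ι ℝ E)
    (hf : ContDiff ℝ ∞ f) :
    Δ f = fun x => ∑ i, fderiv ℝ (fun y => fderiv ℝ f y (b i)) x (b i) := by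
  rw [InnerProductSpace.laplacian_eq_iteratedFDeriv_orthonormalBasis f b]
  funext x
  refine Finset.sum_congr rfl fun i _ => ?_
  rw [iteratedFDeriv_two_apply, fderiv_fderiv_apply_const hf x (b i) (b i)]
  simp

/-- The Laplacian of a smooth map is smooth (private twin of the tree's `contDiff_laplacian`).
[folklore] -/
private theorem contDiff_laplacian_of_smooth (hf : ContDiff ℝ ∞ f) :
    ContDiff ℝ ∞ (Δ f) := by
  rw [laplacian_eq_sum_fderiv_fderiv' (stdOrthonormalBasis ℝ E) hf]
  exact ContDiff.sum fun i _ =>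
    contDiff_fderiv_apply_const (contDiff_fderiv_apply_const hf _) _

/-- The derivative of the Laplacian, termwise: `D(Δ f)(x) w = Σ_i D(∂_{b_i}∂_{b_i} f)(x) w`.
[folklore] -/
private theorem fderiv_laplacian_apply {ι : Type*} [Fintype ι] (b : OrthonormalBasis ι ℝ E)
    (hf : ContDiff ℝ ∞ f) (x w : E) :
    fderiv ℝ (Δ f) x w =
      ∑ i, fderiv ℝ (fun y => fderiv ℝ (fun z => fderiv ℝ f z (b i)) y (b i)) x w := by
  rw [laplacian_eq_sum_fderiv_fderiv' b hf,
    fderiv_fun_sum (A := fun i y => fderiv ℝ (fun z => fderiv ℝ f z (b i)) y (b i))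
      fun i _ => (contDiff_fderiv_apply_const (contDiff_fderiv_apply_const hf _) _).differentiable
        (by simp) x,
    _root_.sum_apply]

/-- **Derivatives along skew linear fields commute with the Laplacian**: for a smooth map
`f : E → F` and a skew-adjoint `K : E →L E` (`⟪Kv, w⟫ = −⟪v, Kw⟫`, an infinitesimal rotation),
`Δ (y ↦ Df(y)(K y)) = (y ↦ D(Δ f)(y)(K y))`. Proof: `Δ = Σ_i ∂_i∂_i`,
`∂_i∂_i X_K f = X_K ∂_i∂_i f + 2 D²f(K b_i, b_i)` and `Σ_i D²f(K b_i, b_i) = 0`. [folklore] -/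
theorem laplacian_fderiv_apply_clm_of_skew (hf : ContDiff ℝ ∞ f) {K : E →L[ℝ] E}
    (hK : ∀ v w : E, ⟪K v, w⟫ = -⟪v, K w⟫) :
    Δ (fun y => fderiv ℝ f y (K y)) = fun x => fderiv ℝ (Δ f) x (K x) := by
  have hX : ContDiff ℝ ∞ (fun y => fderiv ℝ f y (K y)) := contDiff_fderiv_apply_clm hf K
  rw [laplacian_eq_sum_fderiv_fderiv' (stdOrthonormalBasis ℝ E) hX]
  funext x
  rw [fderiv_laplacian_apply (stdOrthonormalBasis ℝ E) hf x (K x)]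
  rw [show (∑ i, fderiv ℝ (fun y => fderiv ℝ (fun z => fderiv ℝ f z (K z)) y
        (stdOrthonormalBasis ℝ E i)) x (stdOrthonormalBasis ℝ E i)) =
      ∑ i, (fderiv ℝ (fun y => fderiv ℝ (fun z => fderiv ℝ f z (stdOrthonormalBasis ℝ E i)) y
        (stdOrthonormalBasis ℝ E i)) x (K x) +
        (2 : ℝ) • fderiv ℝ (fderiv ℝ f) x (K (stdOrthonormalBasis ℝ E i))
          (stdOrthonormalBasis ℝ E i)) from
      Finset.sum_congr rfl fun i _ => fderiv_fderiv_fderiv_apply_clm hf K x _]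
  rw [Finset.sum_add_distrib, ← Finset.smul_sum,
    sum_apply_clm_apply_eq_zero_of_skew (stdOrthonormalBasis ℝ E) (fderiv ℝ (fderiv ℝ f) x)
      (fderiv_fderiv_symm hf x) hK, smul_zero, add_zero]

end Calculus

/-! ## §2 `ℝ³`: the generators, the Casimir and the band defects commute with the Laplacian -/

variable {u : EuclideanSpace ℝ (Fin 3) → EuclideanSpace ℝ (Fin 3)} {L : ℕ}

/-- The cross product with a fixed vector is skew-adjoint: `⟪c × v, w⟫ = −⟪v, c × w⟫` (both are
the triple product). Private twin of the tree's `inner_cross_left_eq_neg`. [folklore] -/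
private theorem inner_crossCLM_left_eq_neg (c v w : EuclideanSpace ℝ (Fin 3)) :
    ⟪crossCLM c v, w⟫ = -⟪v, crossCLM c w⟫ := by
  simp only [crossCLM_apply, cross, PiLp.inner_apply, RCLike.inner_apply, conj_trivial,
    Fin.sum_univ_three, cross_apply, Matrix.cons_val_zero, Matrix.cons_val_one,
    Matrix.cons_val_two, Matrix.head_cons, Matrix.tail_cons]
  ring

/-- **The rotation generators commute with the vector Laplacian**: `J_a (Δ u) = Δ (J_a u)` for
smooth `u : ℝ³ → ℝ³` (`J_a = [e_a]_× ∘ · − X_{[e_a]_×}`: the algebraic part commutes with `Δ` by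
linearity, the transport part by `laplacian_fderiv_apply_clm_of_skew`). [folklore] -/
theorem angGen_laplacian (hu : ContDiff ℝ ∞ u) (a : Fin 3) :
    angGen a (Δ u) = Δ (angGen a u) := by
  rw [angGen_eq a (Δ u), angGen_eq a u]
  have hu2 : ContDiff ℝ 2 u := contDiff_infty.1 hu 2
  have hX : ContDiff ℝ ∞ (fun x => fderiv ℝ u x (crossCLM (axis a) x)) :=
    contDiff_fderiv_apply_clm hu (crossCLM (axis a))
  have hX2 : ContDiff ℝ 2 (fun x => fderiv ℝ u x (crossCLM (axis a) x)) := contDiff_infty.1 hX 2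
  have hC2 : ContDiff ℝ 2 (⇑(crossCLM (axis a)) ∘ u) := (crossCLM (axis a)).contDiff.comp hu2
  have e1 : (fun x => crossCLM (axis a) (u x) - fderiv ℝ u x (crossCLM (axis a) x)) =
      (⇑(crossCLM (axis a)) ∘ u) - fun x => fderiv ℝ u x (crossCLM (axis a) x) := rfl
  rw [e1]
  funext x
  rw [ContDiffAt.laplacian_sub hC2.contDiffAt hX2.contDiffAt,
    ContDiffAt.laplacian_CLM_comp_left hu2.contDiffAt,
    laplacian_fderiv_apply_clm_of_skew hu (inner_crossCLM_left_eq_neg (axis a))]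
  rfl

/-- The Laplacian of a sum of three smooth fields, pointwise. [folklore] -/
private theorem laplacian_add_add_apply {v₁ v₂ v₃ : EuclideanSpace ℝ (Fin 3) → EuclideanSpace ℝ (Fin 3)}
    (h₁ : ContDiff ℝ ∞ v₁) (h₂ : ContDiff ℝ ∞ v₂) (h₃ : ContDiff ℝ ∞ v₃)
    (x : EuclideanSpace ℝ (Fin 3)) :
    Δ (v₁ + v₂ + v₃) x = Δ v₁ x + Δ v₂ x + Δ v₃ x := by
  have h₁2 : ContDiff ℝ 2 v₁ := contDiff_infty.1 h₁ 2
  have h₂2 : ContDiff ℝ 2 v₂ := contDiff_infty.1 h₂ 2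
  have h₃2 : ContDiff ℝ 2 v₃ := contDiff_infty.1 h₃ 2
  have h12 : ContDiff ℝ 2 (v₁ + v₂) := h₁2.add h₂2
  rw [ContDiffAt.laplacian_add h12.contDiffAt h₃2.contDiffAt,
    ContDiffAt.laplacian_add h₁2.contDiffAt h₂2.contDiffAt]

/-- The Casimir as minus the sum of the three squared generators, at the level of functions.
[folklore] -/
private theorem casimir_eq_neg_add (v : EuclideanSpace ℝ (Fin 3) → EuclideanSpace ℝ (Fin 3)) :
    casimir v = -(angGen 0 (angGen 0 v) + angGen 1 (angGen 1 v) + angGen 2 (angGen 2 v)) := by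
  funext x
  simp only [casimir, Fin.sum_univ_three, Pi.neg_apply, Pi.add_apply]

/-- **The Casimir commutes with the vector Laplacian**: `𝒞 (Δ u) = Δ (𝒞 u)` for smooth `u`.
[folklore] -/
theorem casimir_laplacian (hu : ContDiff ℝ ∞ u) : casimir (Δ u) = Δ (casimir u) := by
  rw [casimir_eq_neg_add (Δ u), casimir_eq_neg_add u, InnerProductSpace.laplacian_neg]
  have hJ : ∀ a : Fin 3, ContDiff ℝ ∞ (angGen a (angGen a u)) := fun a =>
    contDiff_angGen (contDiff_angGen hu a) a
  have hΔ : ContDiff ℝ ∞ (Δ u) := contDiff_laplacian_of_smooth hu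
  congr 1
  funext x
  rw [laplacian_add_add_apply (hJ 0) (hJ 1) (hJ 2), Pi.add_apply, Pi.add_apply,
    ← angGen_laplacian (contDiff_angGen hu 0) 0, ← angGen_laplacian (contDiff_angGen hu 1) 1,
    ← angGen_laplacian (contDiff_angGen hu 2) 2, ← angGen_laplacian hu 0, ← angGen_laplacian hu 1,
    ← angGen_laplacian hu 2]

/-- **Every band defect commutes with the vector Laplacian**:
`∏_{j ≤ L}(𝒞 − j(j+1)) (Δ u) = Δ (∏_{j ≤ L}(𝒞 − j(j+1)) u)` for smooth `u`. [folklore] -/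
theorem bandDefect_laplacian (hu : ContDiff ℝ ∞ u) (L : ℕ) :
    bandDefect L (Δ u) = Δ (bandDefect L u) := by
  induction L with
  | zero => exact casimir_laplacian hu
  | succ L ih =>
      have hB : ContDiff ℝ ∞ (bandDefect L u) := contDiff_bandDefect hu L
      have hB2 : ContDiff ℝ 2 (bandDefect L u) := contDiff_infty.1 hB 2
      have hC2 : ContDiff ℝ 2 (casimir (bandDefect L u)) := contDiff_infty.1 (contDiff_casimir hB) 2
      have hS2 : ContDiff ℝ 2 ((((L : ℝ) + 1) * ((L : ℝ) + 2)) • bandDefect L u) :=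
        hB2.const_smul (((L : ℝ) + 1) * ((L : ℝ) + 2))
      have e1 : bandDefect (L + 1) u =
          casimir (bandDefect L u) - (((L : ℝ) + 1) * ((L : ℝ) + 2)) • bandDefect L u := by
        funext x
        rfl
      funext x
      change casimir (bandDefect L (Δ u)) x -
          (((L : ℝ) + 1) * ((L : ℝ) + 2)) • bandDefect L (Δ u) x = Δ (bandDefect (L + 1) u) x
      rw [e1, ContDiffAt.laplacian_sub hC2.contDiffAt hS2.contDiffAt,
        InnerProductSpace.laplacian_smul _ hB2.contDiffAt, ih, casimir_laplacian hB]

/-- **Band-limited fields have band-limited Laplacians**: if `u` is band-limited to angular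
degrees `≤ L` about the origin then so is `Δ u` — the isotypic projections `Π_L` commute with
the Laplacian (each vector-spherical-harmonic isotype with radial coefficients is `Δ`-invariant).
[cite: BullardGellman1954] -/
theorem IsBandLimited.laplacian (hu : IsBandLimited L u) : IsBandLimited L (Δ u) := by
  refine ⟨contDiff_laplacian_of_smooth hu.1, fun x => ?_⟩
  have h0 : bandDefect L u = fun _ => 0 := funext hu.2
  rw [bandDefect_laplacian hu.1 L, h0, InnerProductSpace.laplacian_const]
  rfl

/-- Band-limited fields have band-limited iterated Laplacians `Δ^[n] u`. [folklore] -/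
theorem IsBandLimited.iterate_laplacian (hu : IsBandLimited L u) (n : ℕ) :
    IsBandLimited L (Laplacian.laplacian^[n] u) := by
  induction n with
  | zero => exact hu
  | succ n ih =>
      rw [Function.iterate_succ_apply']
      exact ih.laplacian

/-- **The viscous term stays in the band**: `ν Δ u` is band-limited of degree `≤ L` whenever `u`
is. [folklore] -/
theorem IsBandLimited.viscous (hu : IsBandLimited L u) (ν : ℝ) :
    IsBandLimited L fun x => ν • Δ u x :=
  hu.laplacian.smul ν

/-- On a rung-`L` solution every velocity slice has a band-limited Laplacian `Δ u(t)`, `t ∈ S`.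
[folklore] -/
theorem IsRungSolutionOn.isBandLimited_laplacian {S : Set ℝ} {ν : ℝ}
    {v : ℝ → EuclideanSpace ℝ (Fin 3) → EuclideanSpace ℝ (Fin 3)}
    {p : ℝ → EuclideanSpace ℝ (Fin 3) → ℝ}
    {d : ℝ → EuclideanSpace ℝ (Fin 3) → EuclideanSpace ℝ (Fin 3)}
    (h : IsRungSolutionOn S ν L v p d) {t : ℝ} (ht : t ∈ S) :
    IsBandLimited L (Δ (v t)) :=
  (h.2.1 t ht).laplacian

/-- **The Δ-clause of the structure lemma of `NS_L`**: on a rung-`L` solution the viscous term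
`ν Δ u(t)` of the momentum equation `∂ₜu + (u·∇)u = νΔu − ∇p + d` is band-limited of degree
`≤ L` for every `t ∈ S`. [cite: BullardGellman1954] -/
theorem IsRungSolutionOn.isBandLimited_viscous {S : Set ℝ} {ν : ℝ}
    {v : ℝ → EuclideanSpace ℝ (Fin 3) → EuclideanSpace ℝ (Fin 3)}
    {p : ℝ → EuclideanSpace ℝ (Fin 3) → ℝ}
    {d : ℝ → EuclideanSpace ℝ (Fin 3) → EuclideanSpace ℝ (Fin 3)}
    (h : IsRungSolutionOn S ν L v p d) {t : ℝ} (ht : t ∈ S) :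
    IsBandLimited L fun x => ν • Δ (v t) x :=
  (h.2.1 t ht).viscous ν

end AngularLadder

end Summit.NavierStokesRegularity.FluidComputer

end
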